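import Summits.ResolutionOfSingularities.ResolutionOfSingularities.Theorems.UniversalCellsCampaignW82PinnedTower
import Summits.ResolutionOfSingularities.ResolutionOfSingularities.Theorems.UniversalCellsCampaignW82SmoothTwistGraded
import Summits.ResolutionOfSingularities.ResolutionOfSingularities.Theorems.UniversalCellsCampaignW82FamilyTransferGradedProofs
import Mathlib.RingTheory.AlgebraicIndependent.Transcendental
import Mathlib.Data.Fintype.Option
import HarnessLib

/-!
# [OURS · L1 W8.2] THE DOOR-1 RESIDUAL IS NEEDED ONLY AT THE RATIONAL TOWER: `Res(𝔽_p)` and the perfection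
# step at the countably many fields `(𝔽_p(t₁,…,t_d))^{perf}` give resolution over every perfect field

Cell `res-hironaka` (run/shared/lean/pub/res-hironaka/), LADDER-RESOLUTION rung L (RESCUE), slot W8.2; host route
`UniversalCells`, host item `PrimeFieldToPerfect` (stmt-ResolutionOfSingularities-15233), door 1. Proofs file
(Theses-free), written by res-L1-s82-pv-1 (gen 4). Sequel of `…PinnedTower.lean`
(`perfectRes_of_primeField_of_rationalTower`: `Res(ZMod p)` + resolution over every perfect field purely
inseparable over `Frac 𝔽_p[t_i : i ∈ ι]`, `ι` finite non-empty ⇒ resolution over every perfect field of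
characteristic `p`).

THE SHARPENING. The door-1 I-candidate of L/res-L1-type-o6/W82-TYPED-MAP.md is `∀ p, PerfectionStepDimLe p ⊤`,
i.e. the perfection step `PerfectionStepAt M ⊤` at EVERY perfect `M` of characteristic `p`
(`primeFieldToPerfect_of_forall_perfectionStepDimLe_top`). THIS FILE shows that the step is needed only at the
RATIONAL TOWER: **`rationalTower_of_perfectionStepAt_tower`** — if `PerfectionStepAt M ⊤` holds for every
perfect `M` purely inseparable over `Frac 𝔽_p[t_i : i ∈ ι]` (every finite `ι`; up to isomorphism the countably
many countable fields `(𝔽_p(t₁,…,t_d))^{perf}`, `d ≥ 0`), then `Res(ZMod p)` implies resolution over every field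
of the rational tower, hence (`perfectRes_of_primeField_of_perfectionStepAt_tower`, with `…PinnedTower`) over
EVERY perfect field of characteristic `p`. Proof: induction on `ι` (`Finite.induction_empty_option`): the empty
level is `𝔽_p` (`rationalTower_of_isEmpty_of_primeField`); for `ι ⊕ 1`, inside a tower field `M` of that
level the `p`-radical closure `M₀` of `𝔽_p(t_i : i ∈ ι)` is a tower field of level `ι`
(`exists_rationalTower_algebra`), resolvable by induction; the last variable is transcendental over `M₀`
(`AlgebraicIndependent.transcendental_adjoin` + `Algebra.IsAlgebraic.transcendental_iff`, `M₀` being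
algebraic over `𝔽_p[t_i : i ∈ ι]`, `isAlgebraic_of_forall_pow_mem_adjoin`), so `RatFunc M₀ ⟶ M` is defined
and `M` is perfect purely inseparable over it; the family transfer (`spreadOutRatFuncDimLe_top_top`, gen 0)
and ONE perfection step at `M₀` give `Res(M)`.

HONEST FRAMING. OURS theorems about OURS statements (role replaced: §17 ¶2 p.89 l.59–62 of [Hironaka2017], typed AS
PRINTED as `S17Methodology.U89_3`); NOT statements of the manuscript; nothing attributed to its author; no typed
candidate used. The perfection step itself stays open from dimension `4`; this file only narrows WHERE it must be
proved. AI work, weaker than expert review; no claim beyond the kernel.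
-/

noncomputable section

set_option linter.dupNamespace false -- mandated namespace of this single-conjunct summit

open CategoryTheory CategoryTheory.Limits AlgebraicGeometry TopologicalSpace
open Literature.AlgebraicGeometry.Resolution
open Summit.ResolutionOfSingularities.ResolutionOfSingularities.Theorems.PrimeFieldToPerfect

namespace Summit.ResolutionOfSingularities.ResolutionOfSingularities.Theorems.CampaignW82

/-! ## Lemmas: tower structures and algebraicity of `p`-radical closures -/

/-- **A `p`-radical closure of `𝔽_p(t)` is a tower field.** Let `L` be a perfect field of characteristic `p`,
`t' : ι → L` algebraically independent over `ZMod p`, and `F₁ ⊆ L` the set of `x` with some `x^{p^n} ∈ 𝔽_p(t')`.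
Then `F₁` carries an algebra structure over `Frac 𝔽_p[T_i : i ∈ ι]` (`T_i ↦ t' i`) for which it is purely
inseparable. [folklore] -/
theorem exists_rationalTower_algebra (p : ℕ) [hp : Fact p.Prime] {L : Type} [Field L] [CharP L p]
    [PerfectField L] [Algebra (ZMod p) L] {ι : Type} (t' : ι → L) (ht' : AlgebraicIndependent (ZMod p) t')
    (F₁ : IntermediateField (ZMod p) L)
    (hF₁ : ∀ x : L, x ∈ F₁ ↔ ∃ n : ℕ, x ^ p ^ n ∈ IntermediateField.adjoin (ZMod p) (Set.range t')) :
    ∃ alg : Algebra (FractionRing (MvPolynomial ι (ZMod p))) F₁,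
      @IsPurelyInseparable (FractionRing (MvPolynomial ι (ZMod p))) F₁ _ _ alg := by
  classical
  have hmemF₁ : ∀ y : L, y ∈ IntermediateField.adjoin (ZMod p) (Set.range t') → y ∈ F₁ := fun y hy =>
    (hF₁ y).2 ⟨0, by rwa [pow_zero, pow_one]⟩
  let t'' : ι → F₁ := fun i => ⟨t' i, hmemF₁ _ (IntermediateField.subset_adjoin _ _ ⟨i, rfl⟩)⟩
  have ht'' : AlgebraicIndependent (ZMod p) t'' := AlgebraicIndependent.of_comp F₁.val ht'
  let Rp := MvPolynomial ι (ZMod p)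
  let F := FractionRing Rp
  have hae : Function.Injective (MvPolynomial.aeval t'' : Rp →ₐ[ZMod p] F₁) :=
    algebraicIndependent_iff_injective_aeval.mp ht''
  let ψ : F →+* F₁ := IsFractionRing.lift (g := (MvPolynomial.aeval t'' : Rp →ₐ[ZMod p] F₁).toRingHom) hae
  letI alg : Algebra F F₁ := ψ.toAlgebra
  haveI : CharP F p := charP_of_injective_algebraMap (IsFractionRing.injective Rp F) p
  haveI : ExpChar F p := ExpChar.prime hp.out
  refine ⟨alg, (isPurelyInseparable_iff_pow_mem F p).2 fun x => ?_⟩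
  obtain ⟨n, hn⟩ := (hF₁ x.1).1 x.2
  refine ⟨n, ?_⟩
  have hψc : ∀ c : ZMod p, ψ (algebraMap (ZMod p) F c) = algebraMap (ZMod p) F₁ c := fun c =>
    congrFun (congrArg DFunLike.coe (Subsingleton.elim (ψ.comp (algebraMap (ZMod p) F))
      (algebraMap (ZMod p) F₁))) c
  let Sψ : IntermediateField (ZMod p) F₁ :=
    { ψ.fieldRange with algebraMap_mem' := fun c => ⟨algebraMap (ZMod p) F c, hψc c⟩ }
  have hle : IntermediateField.adjoin (ZMod p) (Set.range t'') ≤ Sψ := by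
    refine IntermediateField.adjoin_le_iff.mpr ?_
    rintro _ ⟨i, rfl⟩
    refine ⟨algebraMap Rp F (MvPolynomial.X i), ?_⟩
    change ψ _ = _
    rw [IsFractionRing.lift_algebraMap]
    change MvPolynomial.aeval t'' (MvPolynomial.X i) = t'' i
    exact MvPolynomial.aeval_X t'' i
  have hmap : (IntermediateField.adjoin (ZMod p) (Set.range t'')).map F₁.val =
      IntermediateField.adjoin (ZMod p) (Set.range t') := by
    rw [IntermediateField.adjoin_map]
    congr 1
    ext y
    constructor
    · rintro ⟨_, ⟨i, rfl⟩, rfl⟩; exact ⟨i, rfl⟩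
    · rintro ⟨i, rfl⟩; exact ⟨t'' i, ⟨i, rfl⟩, rfl⟩
  have hx : x ^ p ^ n ∈ IntermediateField.adjoin (ZMod p) (Set.range t'') := by
    have h1 : (x : L) ^ p ^ n ∈ (IntermediateField.adjoin (ZMod p) (Set.range t'')).map F₁.val := hmap ▸ hn
    rw [← SetLike.mem_coe, IntermediateField.coe_map] at h1
    obtain ⟨z, hz, hzx⟩ := h1
    have : z = x ^ p ^ n := Subtype.ext (by simpa using hzx)
    exact this ▸ hz
  exact hle hx

/-- **A `p`-radical closure of `𝔽_p(S)` is algebraic over `𝔽_p[S]`**: if every `x ∈ M₀` has some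
`x^{p^n} ∈ 𝔽_p(S)` (a quotient `r/s` of elements of `𝔽_p[S]`), then `x` is a root of `s·T^{p^n} − r`. [folklore] -/
theorem isAlgebraic_of_forall_pow_mem_adjoin (p : ℕ) [hp : Fact p.Prime] {L : Type} [Field L]
    [Algebra (ZMod p) L] (S : Set L) (M₀ : IntermediateField (ZMod p) L)
    (hM₀ : ∀ x : L, x ∈ M₀ ↔ ∃ n : ℕ, x ^ p ^ n ∈ IntermediateField.adjoin (ZMod p) S)
    (hle : Algebra.adjoin (ZMod p) S ≤ M₀.toSubalgebra) :
    @Algebra.IsAlgebraic (Algebra.adjoin (ZMod p) S) M₀ _ _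
      (Subalgebra.inclusion hle).toRingHom.toAlgebra := by
  letI : Algebra (Algebra.adjoin (ZMod p) S) M₀ := (Subalgebra.inclusion hle).toRingHom.toAlgebra
  refine ⟨fun x => ?_⟩
  obtain ⟨n, hn⟩ := (hM₀ x.1).1 x.2
  obtain ⟨r, hr, s, hs, hrs⟩ := IntermediateField.mem_adjoin_iff_div.mp hn
  by_cases hs0 : s = 0
  · have hx0 : x = 0 := by
      apply Subtype.ext
      have : (x : L) ^ p ^ n = 0 := by rw [hrs, hs0, div_zero]
      exact pow_eq_zero_iff (pow_ne_zero n hp.out.ne_zero) |>.mp this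
    rw [hx0]; exact isAlgebraic_zero
  refine ⟨Polynomial.C ⟨s, hs⟩ * Polynomial.X ^ p ^ n - Polynomial.C ⟨r, hr⟩, ?_, ?_⟩
  · intro h
    have h1 := congrArg (fun P : Polynomial (Algebra.adjoin (ZMod p) S) => P.coeff (p ^ n)) h
    have hpn : p ^ n ≠ 0 := pow_ne_zero n hp.out.ne_zero
    simp only [Polynomial.coeff_sub, Polynomial.coeff_C_mul, Polynomial.coeff_X_pow_self, mul_one,
      Polynomial.coeff_C, hpn, if_false, sub_zero, Polynomial.coeff_zero] at h1
    exact hs0 (congrArg Subtype.val h1)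
  · apply Subtype.ext
    change ((Polynomial.aeval x) _ : M₀).1 = 0
    simp only [map_sub, map_mul, map_pow, Polynomial.aeval_C, Polynomial.aeval_X]
    change s * (x : L) ^ p ^ n - r = 0
    rw [hrs, mul_div_cancel₀ _ hs0, sub_self]


/-! ## The residual is needed only at the rational tower -/

/-- **THE DOOR-1 RESIDUAL IS NEEDED ONLY AT THE RATIONAL TOWER.** Let `p` be prime; assume resolution of all
integral separated schemes of finite type over `ZMod p`, and the perfection step `PerfectionStepAt M ⊤` for
every perfect field `M` purely inseparable over `Frac 𝔽_p[t_i : i ∈ ι]`, for every finite `ι`. Then every field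
of the rational tower (every such `M`, every finite `ι`) carries resolution of all integral separated schemes of
finite type. Induction on `ι` (`Finite.induction_empty_option`); see the module docstring. [folklore] -/
theorem rationalTower_of_perfectionStepAt_tower (p : ℕ) (hp : p.Prime)
    (h₀ : ∀ (X : Scheme.{0}) (f : X ⟶ Spec (.of (ZMod p))), IsSeparated f → LocallyOfFiniteType f →
      QuasiCompact f → IsIntegral X → Scheme.HasResolution X)
    (hstep : ∀ (ι : Type) [Finite ι] (M : Type) [Field M] [PerfectField M]
      [Algebra (FractionRing (MvPolynomial ι (ZMod p))) M]
      [IsPurelyInseparable (FractionRing (MvPolynomial ι (ZMod p))) M], PerfectionStepAt M ⊤)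
    (ι : Type) [Finite ι] (M : Type) [Field M] [PerfectField M]
    [Algebra (FractionRing (MvPolynomial ι (ZMod p))) M]
    [IsPurelyInseparable (FractionRing (MvPolynomial ι (ZMod p))) M]
    (X : Scheme.{0}) (f : X ⟶ Spec (.of M)) (hs : IsSeparated f) (hl : LocallyOfFiniteType f)
    (hq : QuasiCompact f) (hX : IsIntegral X) : Scheme.HasResolution X := by
  classical
  haveI : Fact p.Prime := ⟨hp⟩
  let P : Type → Prop := fun γ => ∀ (N : Type) [Field N] [PerfectField N]
      [Algebra (FractionRing (MvPolynomial γ (ZMod p))) N]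
      [IsPurelyInseparable (FractionRing (MvPolynomial γ (ZMod p))) N],
      ∀ (Y : Scheme.{0}) (g : Y ⟶ Spec (.of N)), IsSeparated g → LocallyOfFiniteType g →
        QuasiCompact g → IsIntegral Y → Scheme.HasResolution Y
  suffices hP : P ι from hP M X f hs hl hq hX
  refine Finite.induction_empty_option (P := P) ?_ ?_ ?_ ι
  · -- ### invariance under re-indexing
    intro α β e hα N _ _ algβ hpiβ Y g hs' hl' hq' hY
    let Fα := FractionRing (MvPolynomial α (ZMod p))
    let Fβ := FractionRing (MvPolynomial β (ZMod p))
    let eF : Fα ≃+* Fβ :=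
      IsFractionRing.ringEquivOfRingEquiv (MvPolynomial.renameEquiv (ZMod p) e).toRingEquiv
    letI : Algebra Fα N := ((algebraMap Fβ N).comp eF.toRingHom).toAlgebra
    haveI : CharP Fα p :=
      charP_of_injective_algebraMap (IsFractionRing.injective (MvPolynomial α (ZMod p)) Fα) p
    haveI : CharP Fβ p :=
      charP_of_injective_algebraMap (IsFractionRing.injective (MvPolynomial β (ZMod p)) Fβ) p
    haveI : ExpChar Fα p := ExpChar.prime hp
    haveI : ExpChar Fβ p := ExpChar.prime hp
    haveI : IsPurelyInseparable Fα N := by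
      refine (isPurelyInseparable_iff_pow_mem Fα p).2 fun m => ?_
      obtain ⟨n, y, hy⟩ := IsPurelyInseparable.pow_mem Fβ p m
      refine ⟨n, eF.symm y, ?_⟩
      change algebraMap Fβ N (eF (eF.symm y)) = _
      rw [eF.apply_symm_apply]
      exact hy
    exact hα N Y g hs' hl' hq' hY
  · -- ### the empty level is `𝔽_p`
    intro N _ _ _ _ Y g hs' hl' hq' hY
    exact rationalTower_of_isEmpty_of_primeField p hp h₀ PEmpty N Y g hs' hl' hq' hY
  · -- ### the climb `ι ↦ ι ⊕ 1`
    intro α _ hα N _ _ algN hpiN Y g hs' hl' hq' hY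
    let Rp := MvPolynomial (Option α) (ZMod p)
    let F := FractionRing Rp
    haveI : CharP F p := charP_of_injective_algebraMap (IsFractionRing.injective Rp F) p
    haveI : CharP N p := charP_of_injective_algebraMap (algebraMap F N).injective p
    haveI : ExpChar F p := ExpChar.prime hp
    haveI : ExpChar N p := ExpChar.prime hp
    letI algZ : Algebra (ZMod p) N := ZMod.algebra N p
    -- the variables, as an algebraically independent family in `N`
    let x : Option α → N := fun i => algebraMap F N (algebraMap Rp F (MvPolynomial.X i))
    have hcomp : ((MvPolynomial.aeval x : Rp →ₐ[ZMod p] N) : Rp →+* N) =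
        (algebraMap F N).comp (algebraMap Rp F) := by
      apply MvPolynomial.ringHom_ext
      · intro c
        exact congrFun (congrArg DFunLike.coe (Subsingleton.elim
          (((MvPolynomial.aeval x : Rp →ₐ[ZMod p] N) : Rp →+* N).comp MvPolynomial.C)
          (((algebraMap F N).comp (algebraMap Rp F)).comp MvPolynomial.C))) c
      · intro i
        simp [x]
    have hx : AlgebraicIndependent (ZMod p) x := by
      rw [algebraicIndependent_iff_injective_aeval]
      have hinj : Function.Injective ((algebraMap F N).comp (algebraMap Rp F)) :=
        (algebraMap F N).injective.comp (IsFractionRing.injective Rp F)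
      intro a b hab
      apply hinj
      have ha := congrFun (congrArg DFunLike.coe hcomp) a
      have hb := congrFun (congrArg DFunLike.coe hcomp) b
      simp only [RingHom.coe_coe] at ha hb
      rw [← ha, ← hb]
      exact hab
    -- ### the lower level `M₀ ⊆ N`: the `p`-radical closure of `𝔽_p(x_i : i ∈ α)`
    let x₀ : α → N := x ∘ some
    let S : Set N := x '' Set.range (some : α → Option α)
    have hS : S = Set.range x₀ := (Set.range_comp x some).symm
    obtain ⟨M₀, hM₀⟩ := tower_exists_forall_mem_iff p (IntermediateField.adjoin (ZMod p) S)
    haveI : PerfectField M₀ := tower_perfectField_of_forall_mem_iff p hM₀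
    have hM₀' : ∀ z : N, z ∈ M₀ ↔ ∃ n : ℕ, z ^ p ^ n ∈ IntermediateField.adjoin (ZMod p) (Set.range x₀) := by
      simpa only [hS] using hM₀
    have hx₀ : AlgebraicIndependent (ZMod p) x₀ := hx.comp some (Option.some_injective α)
    obtain ⟨alg₀, hpi₀⟩ := exists_rationalTower_algebra p x₀ hx₀ M₀ hM₀'
    letI := alg₀
    haveI := hpi₀
    -- `Res(M₀)` by induction
    have hres₀ : ∀ (Z : Scheme.{0}) (h : Z ⟶ Spec (.of M₀)), IsSeparated h → LocallyOfFiniteType h →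
        QuasiCompact h → IsIntegral Z → Scheme.HasResolution Z := hα M₀
    -- ### the last variable is transcendental over `M₀`
    let y : N := x none
    let A₀ : Subalgebra (ZMod p) N := Algebra.adjoin (ZMod p) S
    have hA₀le : A₀ ≤ M₀.toSubalgebra := by
      refine Algebra.adjoin_le fun z hz => (hM₀ z).2 ⟨0, ?_⟩
      rw [pow_zero, pow_one]
      exact IntermediateField.subset_adjoin _ _ hz
    letI algA : Algebra A₀ M₀ := (Subalgebra.inclusion hA₀le).toRingHom.toAlgebra
    haveI : IsScalarTower A₀ M₀ N := IsScalarTower.of_algebraMap_eq fun _ => rfl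
    haveI : Algebra.IsAlgebraic A₀ M₀ := isAlgebraic_of_forall_pow_mem_adjoin p S M₀ hM₀ hA₀le
    haveI : FaithfulSMul A₀ M₀ :=
      (faithfulSMul_iff_algebraMap_injective _ _).mpr (Subalgebra.inclusion_injective hA₀le)
    have hyA : Transcendental A₀ y :=
      hx.transcendental_adjoin (s := Set.range (some : α → Option α)) (i := none) (by simp)
    have hyM₀ : Transcendental M₀ y := (Algebra.IsAlgebraic.transcendental_iff A₀ M₀).mp hyA
    -- ### `RatFunc M₀ ⟶ N`, `T ↦ y`; `N` is purely inseparable over it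
    have hinj : Function.Injective (Polynomial.aeval y : Polynomial M₀ →ₐ[M₀] N) :=
      transcendental_iff_injective.mp hyM₀
    let ψ : RatFunc M₀ →+* N :=
      IsFractionRing.lift (K := RatFunc M₀) (g := ((Polynomial.aeval y : Polynomial M₀ →ₐ[M₀] N) :
        Polynomial M₀ →+* N)) hinj
    letI algR : Algebra (RatFunc M₀) N := ψ.toAlgebra
    haveI : CharP M₀ p := ((algebraMap M₀ N).charP_iff_charP p).mpr inferInstance
    haveI : ExpChar (RatFunc M₀) p := ExpChar.prime hp
    have hψC : ∀ m : M₀, ψ (algebraMap (Polynomial M₀) (RatFunc M₀) (Polynomial.C m)) = (m : N) := fun m => by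
      change IsFractionRing.lift hinj _ = _
      rw [IsFractionRing.lift_algebraMap]
      change Polynomial.aeval y (Polynomial.C m) = (m : N)
      rw [Polynomial.aeval_C]
      rfl
    have hψX : ψ (algebraMap (Polynomial M₀) (RatFunc M₀) Polynomial.X) = y := by
      change IsFractionRing.lift hinj _ = _
      rw [IsFractionRing.lift_algebraMap]
      change Polynomial.aeval y Polynomial.X = y
      exact Polynomial.aeval_X y
    -- the range of `ψ` contains the `x i`, hence the image of `𝔽_p[x]`, hence that of `F`
    let Tψ : Subalgebra (ZMod p) N :=
      { ψ.fieldRange.toSubring with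
        algebraMap_mem' := fun c => ⟨algebraMap _ _ (Polynomial.C (algebraMap (ZMod p) M₀ c)), by
          rw [hψC]
          exact congrFun (congrArg DFunLike.coe (Subsingleton.elim
            ((algebraMap M₀ N).comp (algebraMap (ZMod p) M₀)) (algebraMap (ZMod p) N))) c⟩ }
    have hxT : Set.range x ⊆ Tψ := by
      rintro _ ⟨i, rfl⟩
      cases i with
      | none => exact ⟨_, hψX⟩
      | some j =>
        have hj : x (some j) ∈ M₀ := (hM₀ _).2 ⟨0, by
          rw [pow_zero, pow_one]
          exact IntermediateField.subset_adjoin _ _ ⟨some j, ⟨j, rfl⟩, rfl⟩⟩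
        exact ⟨_, hψC ⟨x (some j), hj⟩⟩
    have hpoly : ∀ a : Rp, algebraMap F N (algebraMap Rp F a) ∈ ψ.fieldRange := fun a => by
      have h1 : algebraMap F N (algebraMap Rp F a) = MvPolynomial.aeval x a := by
        have := congrFun (congrArg DFunLike.coe hcomp) a
        simpa only [RingHom.coe_coe, RingHom.coe_comp, Function.comp_apply] using this.symm
      rw [h1]
      have h2 : (MvPolynomial.aeval x a : N) ∈ Tψ := by
        have hr : (MvPolynomial.aeval x : Rp →ₐ[ZMod p] N).range ≤ Tψ := by
          rw [MvPolynomial.aeval_range]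
          exact Algebra.adjoin_le hxT
        exact hr ⟨a, rfl⟩
      exact h2
    haveI : IsPurelyInseparable (RatFunc M₀) N := by
      refine (isPurelyInseparable_iff_pow_mem (RatFunc M₀) p).2 fun m => ?_
      obtain ⟨n, z, hz⟩ := IsPurelyInseparable.pow_mem F p m
      refine ⟨n, ?_⟩
      rw [← hz]
      obtain ⟨⟨a, b⟩, hab⟩ := IsLocalization.surj (nonZeroDivisors Rp) z
      have hb : algebraMap F N (algebraMap Rp F b) ≠ 0 :=
        (map_ne_zero_iff _ (algebraMap F N).injective).mpr
          ((map_ne_zero_iff _ (IsFractionRing.injective Rp F)).mpr (nonZeroDivisors.ne_zero b.2))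
      have hzq : algebraMap F N z =
          algebraMap F N (algebraMap Rp F a) / algebraMap F N (algebraMap Rp F b) := by
        rw [eq_div_iff hb, ← map_mul]
        exact congrArg _ hab
      rw [hzq]
      exact RingHom.mem_range.mpr (RingHom.mem_fieldRange.mp (div_mem (hpoly a) (hpoly b)))
    -- ### `Res(RatFunc M₀)` by the family transfer, then ONE perfection step at `M₀`
    have hrat : ∀ (Z : Scheme.{0}) (h : Z ⟶ Spec (.of (RatFunc M₀))), IsSeparated h →
        LocallyOfFiniteType h → QuasiCompact h → IsIntegral Z → topologicalKrullDim Z ≤ (⊤ : WithBot ℕ∞) →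
          Scheme.HasResolution Z :=
      spreadOutRatFuncDimLe_top_top p M₀ (fun Z h hsZ hlZ hqZ hZ _ => hres₀ Z h hsZ hlZ hqZ hZ)
    exact hstep α M₀ hrat N Y g hs' hl' hq' hY le_top

/-- **Hence: `Res(𝔽_p)` and the perfection step at the rational tower give resolution over EVERY perfect field
of characteristic `p`** (integral schemes; `perfectRes_of_primeField_of_rationalTower`). The door-1 I-candidate
pinned: the open residual `PerfectionStepAt M ⊤` need only be proved for the countably many countable fields
`M ≅ (𝔽_p(t₁,…,t_d))^{perf}`, `d ≥ 0`. [folklore] -/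
theorem perfectRes_of_primeField_of_perfectionStepAt_tower (p : ℕ) (hp : p.Prime)
    (h₀ : ∀ (X : Scheme.{0}) (f : X ⟶ Spec (.of (ZMod p))), IsSeparated f → LocallyOfFiniteType f →
      QuasiCompact f → IsIntegral X → Scheme.HasResolution X)
    (hstep : ∀ (ι : Type) [Finite ι] (M : Type) [Field M] [PerfectField M]
      [Algebra (FractionRing (MvPolynomial ι (ZMod p))) M]
      [IsPurelyInseparable (FractionRing (MvPolynomial ι (ZMod p))) M], PerfectionStepAt M ⊤)
    (k : Type) [Field k] [CharP k p] [PerfectField k] (X : Scheme.{0}) (f : X ⟶ Spec (.of k))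
    (hs : IsSeparated f) (hl : LocallyOfFiniteType f) (hq : QuasiCompact f) (hX : IsIntegral X) :
    Scheme.HasResolution X :=
  perfectRes_of_primeField_of_rationalTower p hp h₀
    (fun ι _ _ M _ _ _ _ Y g hs' hl' hq' hY =>
      rationalTower_of_perfectionStepAt_tower p hp h₀ hstep ι M Y g hs' hl' hq' hY)
    k X f hs hl hq hX

/-- **The same for REDUCED schemes** (conclusion shape of the crux at `p`). [folklore] -/
theorem reducedRes_of_primeField_of_perfectionStepAt_tower (p : ℕ) (hp : p.Prime)
    (h₀ : ∀ (X : Scheme.{0}) (f : X ⟶ Spec (.of (ZMod p))), IsSeparated f → LocallyOfFiniteType f →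
      QuasiCompact f → IsIntegral X → Scheme.HasResolution X)
    (hstep : ∀ (ι : Type) [Finite ι] (M : Type) [Field M] [PerfectField M]
      [Algebra (FractionRing (MvPolynomial ι (ZMod p))) M]
      [IsPurelyInseparable (FractionRing (MvPolynomial ι (ZMod p))) M], PerfectionStepAt M ⊤)
    (k : Type) [Field k] [CharP k p] [PerfectField k] (X : Scheme.{0}) (f : X ⟶ Spec (.of k))
    (hs : IsSeparated f) (hl : LocallyOfFiniteType f) (hq : QuasiCompact f) (hX : IsReduced X) :
    Scheme.HasResolution X :=
  Summit.ResolutionOfSingularities.ResolutionOfSingularities.Theorems.descentReducedToIntegral_proof k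
    (fun Y g hs' hl' hq' hY => perfectRes_of_primeField_of_perfectionStepAt_tower p hp h₀ hstep k Y g hs' hl' hq' hY)
    X f hs hl hq hX

end Summit.ResolutionOfSingularities.ResolutionOfSingularities.Theorems.CampaignW82

end
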